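import Literature.MathematicalPhysics.QuantumFieldTheory.Balaban1983to89.Beta.AssemblyRemainder
import Literature.MathematicalPhysics.QuantumFieldTheory.Balaban1983to89.Beta.Drift

/-!
# `Balaban1983to89.NodeOClassTube` — THE INTER-SCALE CLASS of coupling histories pinned at a target endpoint, and the LOCATED endpoint
# statement `EndpointExistenceWithin` (T. Bałaban, CMP **109** (1987) [I] = [Balaban1987RG1] (0.17)–(0.20) pp. 255–256, Thm 2 p. 259;
# CMP **119** (1988) [III] = [Balaban1988Convergent] (2.4)–(2.9) pp. 255–256, esp. the inter-scale law (2.6) p. 255)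

statement-level skeleton of published theorems with citation tags; proofs where landed; nothing here is a claim about the Yang–Mills mass gap

CITATION HEADER (lean-in-tree rule).  Ideation cell `ym-nodeO-ideate` (portfolio track), seat P3 «weaken the target», memo `memos/ROUTE-P3.md`
v3.18 §12 (v3.17 sha256 9b14a277…, §11), LANDING EDITION (generation 18), module 1 of 2 of the β-side «class road»: the portable §1–§2 of the
crux line registered on item stmt-QuantumFields-19181 (`Summits/QuantumFields/YangMills/Cruxes/EndpointGivenB/Lines/class_road.lean`, sha16
af0600b7def32d6e, :57–:272, farm rc 0) — itself character-identical to the cell companion `memos/ROUTE-P3-Sketch.lean` §B ∕ §B′ (farm rc 0 since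
2026-08-24).  Declaration and proof lines below are CHARACTER-IDENTICAL to those lines; edition deltas = the namespace
(`Summit.QuantumFields.YangMills.Cruxes.EndpointGivenB.ClassRoad` → this module's), this header, the imports cut to the two used, the opens, one-line
docstrings ADDED to the 17 previously undocumented lemmas, and a `[cite: …]` ∕ `[folklore]` tag APPENDED to every docstring (gate rule: every public
theorem ∕ Prop of a Literature file names the printed locus it is bookkeeping for; the parenthesis in each tag says what is NOT claimed).
LABELS in the docstrings (memo-side words, NOT tree declarations): «AF tube», «inter-scale tube», «(2.6)-class», «companion §B ∕ §B′»; «[I]» =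
[Balaban1987RG1]; «[III]» = [Balaban1988Convergent].

PRINT STATUS (LIT `lit/SOURCES.md` §1.1 ∕ §6).  PRINTED: the history recursion (0.20) `1/g_{k+1}² = 1/g_k² + β_{k+1}(g_0,…,g_k)` [I] p. 256
(tree `FlowStep.RGEqH`), Thm 2 [I] p. 259 (tree `B12.Thm2Printed`; UNPROVED in print beyond the announcement, and here), the inter-scale law
(2.6) [III] p. 255 `g_m^{-2} ≤ g_n^{-2} + β′(n − m)`, `g_m ≤ (1 + β₀) g_n` (`m < n`) under which the densities of [III]–[V] are constructed.
NOT PRINTED AS SUCH: the backward map `backMap`, the tubes, `EndpointExistenceWithin` — [folklore] real analysis over the tree's typed carriers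
(`FlowStep.HBeta`, `FlowStepRuns.prefixOf`, `DagBinding.EndpointExistence`), typed by the cell; the identification «fixed points of `backMap` =
solutions of (0.20) ending at `g_K = g`» is `rgEqH_of_fixedPoint` below.

WHAT IS PROVED (sorry-free, axiom-free beyond propext ∕ Classical.choice ∕ Quot.sound).
* §1 `idx`, `cpl`, **`backMap`** (`T(y)_k = 1/g² + Σ_{j∈[k,K)} β_j(g_0(y),…,g_j(y))` in the coordinates `y_k = 1/g_k²`), `Tube`, `AFTube`
  (envelopes `tubeLo ∕ tubeHi = 1/g² + (b ∓ r)(K − k) ∓ 2A`), membership ∕ compactness ∕ convexity ∕ box lemmas.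
* §2 **`InterScaleTube K g b A r r'`** (`y_K = 1/g²`, `(b − r)(n − m) − 2A ≤ y_m − y_n ≤ (b + r′)(n − m) + 2A` for `m ≤ n`): closed, convex,
  compact, nonempty (the one-loop line is a member), contained in the AF tube; **`running26_of_mem`** = print's (2.6) on the members with
  `β′ = b + r′ + 2A`, `(1 + β₀)² = 1 + 2Aγ²`; **`InterScaleRemainder`** (the second-order remainder `−r ≤ β¹ ≤ r′` asked on member histories
  ONLY); **`backMap_mapsTo_interScaleTube`** (drift `A` + remainder on the class ⇒ `T` maps the class into itself — NO sign ∕ upper bound on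
  `β` box-wide); `rgEqH_of_fixedPoint`; **`EndpointExistenceWithin`** (the END rung with the run located in the class) and
  `endpointExistence_of_within` (it implies the tree's `DagBinding.EndpointExistence`).
Module 2 (`NodeOClassRoad`) adds continuity on the class, the Brouwer step and the datum-level theorem `ClassSpec D → EndpointExistence D.C.toB12`.

WHAT THIS IS NOT.  NOT Thm 2 of [I] and not a proof of any β-property of Bałaban's `β_{k+1}` ((1.19)–(1.22) [I] pp. 263–264 are not touched);
every β-side property is a HYPOTHESIS (`OneLoopDrift`, `InterScaleRemainder`) of the theorems; NOT an inhabitant of `FiniteEpsData`; no node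
of any plan is claimed closed; finite-ε four-torus bookkeeping only — nothing continuum ∕ ℝ⁴ ∕ OS ∕ mass-gap ∕ Clay.  NEW file, imports built
tree modules only; nothing modified; no `instance`, no `notation`.  Net new unproved facts: 0.
[cite: Balaban1987RG1, (0.17)-(0.20) pp.255-256, Thm 2 p.259; Balaban1988Convergent, (2.4)-(2.9) pp.255-256] -/

noncomputable section

namespace Literature.MathematicalPhysics.QuantumFieldTheory.Balaban1983to89.NodeOClassTube

open Set Metric
open Literature.MathematicalPhysics.QuantumFieldTheory.Balaban1983to89.FlowStep
open Literature.MathematicalPhysics.QuantumFieldTheory.Balaban1983to89.FlowStepRuns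
open Literature.MathematicalPhysics.QuantumFieldTheory.Balaban1983to89.DagBinding
open Literature.MathematicalPhysics.QuantumFieldTheory.Balaban1983to89.Beta.Drift

/-! ## §1  The backward map and tubes [folklore] -/
section Tube

open Finset

/-- Saturating index into `Fin (K+1)`. [folklore] -/
def idx (K i : ℕ) : Fin (K + 1) := ⟨min i K, by omega⟩

/-- Below `K` the saturating index is the identity. [cite: Balaban1987RG1, (0.20) p.256 (typed bookkeeping for the history recursion in the coordinates `y_k = 1/g_k²`; not a statement about the paper)] -/
theorem idx_val_of_le {K i : ℕ} (h : i ≤ K) : ((idx K i : Fin (K + 1)) : ℕ) = i := min_eq_left h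

/-- On `Fin (K+1)` the saturating index is the identity. [cite: Balaban1987RG1, (0.20) p.256 (typed bookkeeping for the history recursion in the coordinates `y_k = 1/g_k²`; not a statement about the paper)] -/
@[simp] theorem idx_fin {K : ℕ} (k : Fin (K + 1)) : idx K k = k :=
  Fin.ext (min_eq_left (Nat.le_of_lt_succ k.isLt))

/-- The couplings read off a point `y` of `ℝ^{K+1}` in the coordinates `y_k = 1/g_k²`. [folklore] -/
def cpl (K : ℕ) (y : Fin (K + 1) → ℝ) (i : ℕ) : ℝ := 1 / Real.sqrt (y (idx K i))

/-- **The backward map** `T(y)_k := 1/g² + Σ_{j∈[k,K)} β_j(g_0(y),…,g_j(y))`: its fixed points are exactly the solutions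
of the history recursion (0.20) `RGEqH` ending at `g_K = g`. [cite: Balaban1987RG1, (0.20) p.256 (the recursion (0.20) solved BACKWARD from `g_K = g` as a fixed-point problem; bookkeeping, not the paper's argument)] -/
def backMap (β : HBeta) (K : ℕ) (g : ℝ) (y : Fin (K + 1) → ℝ) : Fin (K + 1) → ℝ :=
  fun k => 1 / g ^ 2 + ∑ j ∈ Finset.Ico (k : ℕ) K, β j (prefixOf (cpl K y) j)

/-- A tube = a product of closed intervals in `ℝ^{K+1}`. [folklore] -/
def Tube (K : ℕ) (lo hi : Fin (K + 1) → ℝ) : Set (Fin (K + 1) → ℝ) :=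
  Set.pi Set.univ fun k => Set.Icc (lo k) (hi k)

variable {β : HBeta} {K : ℕ} {lo hi : Fin (K + 1) → ℝ} {γ g : ℝ}

/-- Membership in a tube, coordinatewise. [cite: Balaban1987RG1, (0.20) p.256; Balaban1988Convergent, (2.6) p.255 (tubes of inverse squared couplings around the one-loop line; bookkeeping, not a statement about the papers)] -/
theorem mem_tube {y : Fin (K + 1) → ℝ} : y ∈ Tube K lo hi ↔ ∀ k, lo k ≤ y k ∧ y k ≤ hi k := by
  simp only [Tube, Set.mem_univ_pi, Set.mem_Icc]

/-- Tubes are compact. [cite: Balaban1987RG1, (0.20) p.256; Balaban1988Convergent, (2.6) p.255 (tubes of inverse squared couplings around the one-loop line; bookkeeping, not a statement about the papers)] -/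
theorem isCompact_tube : IsCompact (Tube K lo hi) := isCompact_univ_pi fun _ => isCompact_Icc

/-- Tubes are convex. [cite: Balaban1987RG1, (0.20) p.256; Balaban1988Convergent, (2.6) p.255 (tubes of inverse squared couplings around the one-loop line; bookkeeping, not a statement about the papers)] -/
theorem convex_tube : Convex ℝ (Tube K lo hi) := convex_pi fun _ _ => convex_Icc _ _

/-- A tube with `lo ≤ hi` is nonempty. [cite: Balaban1987RG1, (0.20) p.256; Balaban1988Convergent, (2.6) p.255 (tubes of inverse squared couplings around the one-loop line; bookkeeping, not a statement about the papers)] -/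
theorem tube_nonempty (h : ∀ k, lo k ≤ hi k) : (Tube K lo hi).Nonempty := ⟨lo, mem_tube.2 fun k => ⟨le_rfl, h k⟩⟩

/-- Couplings read off positive coordinates are positive. [cite: Balaban1987RG1, (0.20) p.256 (typed bookkeeping for the history recursion in the coordinates `y_k = 1/g_k²`; not a statement about the paper)] -/
theorem cpl_pos {y : Fin (K + 1) → ℝ} {i : ℕ} (h : 0 < y (idx K i)) : 0 < cpl K y i := by
  unfold cpl; have := Real.sqrt_pos.2 h; positivity

/-- `1/g_i(y)² = y_i` on nonnegative coordinates. [cite: Balaban1987RG1, (0.20) p.256 (typed bookkeeping for the history recursion in the coordinates `y_k = 1/g_k²`; not a statement about the paper)] -/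
theorem inv_sq_cpl {y : Fin (K + 1) → ℝ} {i : ℕ} (h : 0 ≤ y (idx K i)) : 1 / (cpl K y i) ^ 2 = y (idx K i) := by
  unfold cpl; rw [div_pow, one_pow, Real.sq_sqrt h, one_div_one_div]

/-- `y_i ≥ 1/γ²` gives `g_i(y) ≤ γ`. [cite: Balaban1987RG1, (0.20) p.256 (typed bookkeeping for the history recursion in the coordinates `y_k = 1/g_k²`; not a statement about the paper)] -/
theorem cpl_le {y : Fin (K + 1) → ℝ} {i : ℕ} (hγ : 0 < γ) (h : 1 / γ ^ 2 ≤ y (idx K i)) : cpl K y i ≤ γ := by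
  unfold cpl
  have h1 : 1 / γ ≤ Real.sqrt (y (idx K i)) := by
    rw [show (1 : ℝ) / γ = Real.sqrt ((1 / γ) ^ 2) from (Real.sqrt_sq (by positivity)).symm]
    exact Real.sqrt_le_sqrt (by rw [div_pow, one_pow]; exact h)
  calc 1 / Real.sqrt (y (idx K i)) ≤ 1 / (1 / γ) := one_div_le_one_div_of_le (by positivity) h1
    _ = γ := one_div_one_div γ

/-- Tube points with `1/γ² ≤ lo` read as histories in the box `]0,γ]`. [cite: Balaban1987RG1, (0.20) p.256; Balaban1988Convergent, (2.6) p.255 (tubes of inverse squared couplings around the one-loop line; bookkeeping, not a statement about the papers)] -/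
theorem prefix_cpl_mem_box {y : Fin (K + 1) → ℝ} (hγ : 0 < γ) (hlo : ∀ k, 1 / γ ^ 2 ≤ lo k)
    (hy : y ∈ Tube K lo hi) (j : ℕ) : prefixOf (cpl K y) j ∈ Box γ j := by
  rw [mem_box]; intro i
  have hyi : 1 / γ ^ 2 ≤ y (idx K i) := (hlo _).trans ((mem_tube.1 hy) _).1
  have hpos : 0 < y (idx K i) := lt_of_lt_of_le (by positivity) hyi
  exact ⟨cpl_pos hpos, cpl_le hγ hyi⟩

/-- Lower envelope `1/g² + (b − r)(K − k) − 2A`. [folklore] -/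
def tubeLo (g b r A : ℝ) (K : ℕ) : Fin (K + 1) → ℝ := fun k => 1 / g ^ 2 + (b - r) * ((K : ℝ) - (k : ℕ)) - 2 * A

/-- Upper envelope `1/g² + (b + r′)(K − k) + 2A`. [folklore] -/
def tubeHi (g b r' A : ℝ) (K : ℕ) : Fin (K + 1) → ℝ := fun k => 1 / g ^ 2 + (b + r') * ((K : ℝ) - (k : ℕ)) + 2 * A

/-- **THE AF TUBE at `(g, K)`**: histories whose inverse squared couplings run, up to the drift defect `2A` and the
remainder slacks `r, r′`, like the one-loop law BACKWARD from the endpoint: `1/g_k² ≈ 1/g² + b(K − k)`. [folklore] -/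
abbrev AFTube (g b A r r' : ℝ) (K : ℕ) : Set (Fin (K + 1) → ℝ) := Tube K (tubeLo g b r A K) (tubeHi g b r' A K)

/-- The lower envelope stays above `1/γ²` when `1/g² ≥ 1/γ² + 2A` and `r ≤ b`. [cite: Balaban1987RG1, (0.20) p.256; Balaban1988Convergent, (2.6) p.255 (tubes of inverse squared couplings around the one-loop line; bookkeeping, not a statement about the papers)] -/
theorem tubeLo_ge {b r A : ℝ} (hgA : 1 / γ ^ 2 + 2 * A ≤ 1 / g ^ 2) (hbr : 0 ≤ b - r) (k : Fin (K + 1)) :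
    1 / γ ^ 2 ≤ tubeLo g b r A K k := by
  have hk : ((k : ℕ) : ℝ) ≤ K := Nat.cast_le.2 (Nat.le_of_lt_succ k.isLt)
  have : 0 ≤ (b - r) * ((K : ℝ) - (k : ℕ)) := mul_nonneg hbr (sub_nonneg.2 hk)
  simp only [tubeLo]; linarith

/-- The envelopes are ordered. [cite: Balaban1987RG1, (0.20) p.256; Balaban1988Convergent, (2.6) p.255 (tubes of inverse squared couplings around the one-loop line; bookkeeping, not a statement about the papers)] -/
theorem tubeLo_le_hi {b r r' A : ℝ} (hA : 0 ≤ A) (hrr : 0 ≤ r + r') (k : Fin (K + 1)) :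
    tubeLo g b r A K k ≤ tubeHi g b r' A K k := by
  have hk : ((k : ℕ) : ℝ) ≤ K := Nat.cast_le.2 (Nat.le_of_lt_succ k.isLt)
  have : 0 ≤ (r + r') * ((K : ℝ) - (k : ℕ)) := mul_nonneg hrr (sub_nonneg.2 hk)
  simp only [tubeLo, tubeHi]; nlinarith

/-! ## §2  The INTER-SCALE tube pinned at the target endpoint — a compact convex sub-class of the (2.6)-class ([III] p. 255) -/

/-- **THE INTER-SCALE TUBE at `(g, K)`**: `y_K = 1/g²` and, for all scales `m ≤ n ≤ K`,
`(b − r)(n − m) − 2A ≤ y_m − y_n ≤ (b + r′)(n − m) + 2A`. [cite: Balaban1988Convergent, (2.6) p.255 (the inter-scale law typed as a compact convex class pinned at the endpoint; bookkeeping, not a statement about the paper)] -/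
def InterScaleTube (K : ℕ) (g b A r r' : ℝ) : Set (Fin (K + 1) → ℝ) :=
  {y | y (Fin.last K) = 1 / g ^ 2} ∩
    ⋂ (m : Fin (K + 1)) (n : Fin (K + 1)) (_ : m ≤ n),
      ({y | (b - r) * (((n : ℕ) : ℝ) - ((m : ℕ) : ℝ)) - 2 * A ≤ y m - y n} ∩
        {y | y m - y n ≤ (b + r') * (((n : ℕ) : ℝ) - ((m : ℕ) : ℝ)) + 2 * A})

/-- Membership in the inter-scale tube, unfolded. [cite: Balaban1988Convergent, (2.6) p.255 (the inter-scale law typed as a compact convex class pinned at the endpoint; bookkeeping, not a statement about the paper)] -/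
theorem mem_interScaleTube {y : Fin (K + 1) → ℝ} {b A r r' : ℝ} :
    y ∈ InterScaleTube K g b A r r' ↔ y (Fin.last K) = 1 / g ^ 2 ∧
      ∀ m n : Fin (K + 1), m ≤ n →
        (b - r) * (((n : ℕ) : ℝ) - ((m : ℕ) : ℝ)) - 2 * A ≤ y m - y n ∧
          y m - y n ≤ (b + r') * (((n : ℕ) : ℝ) - ((m : ℕ) : ℝ)) + 2 * A := by
  simp only [InterScaleTube, Set.mem_inter_iff, Set.mem_iInter, Set.mem_setOf_eq]

/-- The inter-scale tube is closed. [cite: Balaban1988Convergent, (2.6) p.255 (the inter-scale law typed as a compact convex class pinned at the endpoint; bookkeeping, not a statement about the paper)] -/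
theorem isClosed_interScaleTube {b A r r' : ℝ} : IsClosed (InterScaleTube K g b A r r') := by
  refine (isClosed_eq (continuous_apply _) continuous_const).inter ?_
  refine isClosed_iInter fun m => isClosed_iInter fun n => isClosed_iInter fun _ => ?_
  have hc : Continuous fun y : Fin (K + 1) → ℝ => y m - y n := (continuous_apply m).sub (continuous_apply n)
  exact (isClosed_le continuous_const hc).inter (isClosed_le hc continuous_const)

/-- The inter-scale tube is convex. [cite: Balaban1988Convergent, (2.6) p.255 (the inter-scale law typed as a compact convex class pinned at the endpoint; bookkeeping, not a statement about the paper)] -/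
theorem convex_interScaleTube {b A r r' : ℝ} : Convex ℝ (InterScaleTube K g b A r r') := by
  have hl : ∀ m n : Fin (K + 1), IsLinearMap ℝ fun y : Fin (K + 1) → ℝ => y m - y n := fun m n =>
    { map_add := fun x z => by simp only [Pi.add_apply]; ring
      map_smul := fun c x => by simp only [Pi.smul_apply, smul_eq_mul]; ring }
  have hp : IsLinearMap ℝ fun y : Fin (K + 1) → ℝ => y (Fin.last K) :=
    { map_add := fun x z => rfl, map_smul := fun c x => rfl }
  refine (convex_hyperplane hp _).inter ?_
  refine convex_iInter fun m => convex_iInter fun n => convex_iInter fun _ => ?_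
  exact (convex_halfSpace_ge (hl m n) _).inter (convex_halfSpace_le (hl m n) _)

/-- The inter-scale tube lies in the AF tube (take `n = K`). [cite: Balaban1988Convergent, (2.6) p.255 (the inter-scale law typed as a compact convex class pinned at the endpoint; bookkeeping, not a statement about the paper)] -/
theorem interScaleTube_subset_afTube {b A r r' : ℝ} : InterScaleTube K g b A r r' ⊆ AFTube g b A r r' K := by
  intro y hy
  obtain ⟨hpin, hrun⟩ := mem_interScaleTube.1 hy
  rw [mem_tube]
  intro k
  have h := hrun k (Fin.last K) (Fin.le_last k)
  rw [hpin, Fin.val_last] at h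
  simp only [tubeLo, tubeHi]
  constructor <;> linarith [h.1, h.2]

/-- The inter-scale tube is compact. [cite: Balaban1988Convergent, (2.6) p.255 (the inter-scale law typed as a compact convex class pinned at the endpoint; bookkeeping, not a statement about the paper)] -/
theorem isCompact_interScaleTube {b A r r' : ℝ} : IsCompact (InterScaleTube K g b A r r') :=
  isCompact_tube.of_isClosed_subset isClosed_interScaleTube interScaleTube_subset_afTube

/-- The one-loop line `y_k = 1/g² + b(K − k)` is a member. [cite: Balaban1988Convergent, (2.6) p.255 (the inter-scale law typed as a compact convex class pinned at the endpoint; bookkeeping, not a statement about the paper)] -/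
theorem oneLoopLine_mem {b A r r' : ℝ} (hA : 0 ≤ A) (hr : 0 ≤ r) (hr' : 0 ≤ r') :
    (fun k : Fin (K + 1) => 1 / g ^ 2 + b * ((K : ℝ) - (k : ℕ))) ∈ InterScaleTube K g b A r r' := by
  refine mem_interScaleTube.2 ⟨?_, fun m n hmn => ?_⟩
  · simp only [Fin.val_last, sub_self, mul_zero, add_zero]
  · have hmn' : ((m : ℕ) : ℝ) ≤ ((n : ℕ) : ℝ) := Nat.cast_le.2 (Fin.le_def.1 hmn)
    constructor <;> nlinarith [mul_nonneg hr (sub_nonneg.2 hmn'), mul_nonneg hr' (sub_nonneg.2 hmn')]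

/-- The inter-scale tube is nonempty (`0 ≤ A`, `0 ≤ r`, `0 ≤ r′`). [cite: Balaban1988Convergent, (2.6) p.255 (the inter-scale law typed as a compact convex class pinned at the endpoint; bookkeeping, not a statement about the paper)] -/
theorem interScaleTube_nonempty {b A r r' : ℝ} (hA : 0 ≤ A) (hr : 0 ≤ r) (hr' : 0 ≤ r') :
    (InterScaleTube K g b A r r').Nonempty := ⟨_, oneLoopLine_mem hA hr hr'⟩

/-- **PRINT'S (2.6) ON THE MEMBERS** ([III] p. 255), in the variables `y_k = 1/g_k²`: for `m < n`,
`y_m ≤ y_n + (b + r′ + 2A)(n − m)` (the upper running with `β′ = b + r′ + 2A`) and `y_n ≤ y_m + 2A` (near-monotonicity: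
`g_m² ≤ (1 + 2A·g_m²)·g_n²`, i.e. `(1 + β₀)² = 1 + 2Aγ²` on `]0,γ]`), provided `r ≤ b`. [cite: Balaban1988Convergent, (2.6) p.255 (the inter-scale law typed as a compact convex class pinned at the endpoint; bookkeeping, not a statement about the paper)] -/
theorem running26_of_mem {y : Fin (K + 1) → ℝ} {b A r r' : ℝ} (hA : 0 ≤ A) (hbr : r ≤ b)
    (hy : y ∈ InterScaleTube K g b A r r') {m n : Fin (K + 1)} (hmn : m < n) :
    y m ≤ y n + (b + r' + 2 * A) * (((n : ℕ) : ℝ) - ((m : ℕ) : ℝ)) ∧ y n ≤ y m + 2 * A := by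
  have h := (mem_interScaleTube.1 hy).2 m n hmn.le
  have h1 : (1 : ℝ) ≤ ((n : ℕ) : ℝ) - ((m : ℕ) : ℝ) := by
    have := Fin.lt_def.1 hmn
    have : ((m : ℕ) : ℝ) + 1 ≤ ((n : ℕ) : ℝ) := by exact_mod_cast this
    linarith
  constructor <;> nlinarith [h.1, h.2, mul_nonneg (sub_nonneg.2 hbr) (by linarith : (0 : ℝ) ≤ ((n : ℕ) : ℝ) - ((m : ℕ) : ℝ))]

/-- **(D4) ON THE INTER-SCALE TUBE**: `−r ≤ β¹_{k+1} ≤ r′` asked ONLY at histories read off members of the inter-scale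
tubes — a sub-class of print's (2.6)-class (`running26_of_mem`). [cite: Balaban1987RG1, (1.22) p.264 (the second-order remainder `β¹` of the split (1.19)–(1.22), asked on member histories only — a HYPOTHESIS shape, not a statement about the paper)] -/
def InterScaleRemainder (S : B12Beta.OneLoopSplit β) (γ b A r r' : ℝ) : Prop :=
  ∀ g : ℝ, 0 < g → 1 / γ ^ 2 + 2 * A ≤ 1 / g ^ 2 → ∀ (K : ℕ) (y : Fin (K + 1) → ℝ),
    y ∈ InterScaleTube K g b A r r' →
      ∀ k, k < K → -r ≤ S.β1 k (prefixOf (cpl K y) k) ∧ S.β1 k (prefixOf (cpl K y) k) ≤ r'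

/-- Invariance of the inter-scale tube under the backward map: drift of `β⁰` between ANY two scales
(`Drift.abs_sum_Ico_sub_le_of_drift`) + the remainder bounds on members. [cite: Balaban1987RG1, (0.20) p.256; Balaban1988Convergent, (2.6) p.255 (drift + remainder on the class keep the backward map inside the class; [folklore] real analysis, not the papers' argument)] -/
theorem backMap_mapsTo_interScaleTube (S : B12Beta.OneLoopSplit β) {b A r r' : ℝ}
    (hdrift : OneLoopDrift b A S.β0)
    (hrem : ∀ y ∈ InterScaleTube K g b A r r', ∀ k, k < K →
      -r ≤ S.β1 k (prefixOf (cpl K y) k) ∧ S.β1 k (prefixOf (cpl K y) k) ≤ r') :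
    MapsTo (backMap β K g) (InterScaleTube K g b A r r') (InterScaleTube K g b A r r') := by
  intro y hy
  refine mem_interScaleTube.2 ⟨?_, fun m n hmn => ?_⟩
  · show 1 / g ^ 2 + ∑ j ∈ Finset.Ico ((Fin.last K : Fin (K + 1)) : ℕ) K, β j (prefixOf (cpl K y) j) = 1 / g ^ 2
    rw [Fin.val_last, Finset.Ico_self, Finset.sum_empty, add_zero]
  · have hmn' : (m : ℕ) ≤ (n : ℕ) := Fin.le_def.1 hmn
    have hnK : (n : ℕ) ≤ K := Nat.le_of_lt_succ n.isLt
    have hdiff : backMap β K g y m - backMap β K g y n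
        = ∑ j ∈ Finset.Ico (m : ℕ) n, β j (prefixOf (cpl K y) j) := by
      show (1 / g ^ 2 + ∑ j ∈ Finset.Ico (m : ℕ) K, β j (prefixOf (cpl K y) j))
          - (1 / g ^ 2 + ∑ j ∈ Finset.Ico (n : ℕ) K, β j (prefixOf (cpl K y) j)) = _
      rw [← Finset.sum_Ico_consecutive _ hmn' hnK]
      ring
    have hsplit : ∑ j ∈ Finset.Ico (m : ℕ) n, β j (prefixOf (cpl K y) j)
        = ∑ j ∈ Finset.Ico (m : ℕ) n, S.β0 j + ∑ j ∈ Finset.Ico (m : ℕ) n, S.β1 j (prefixOf (cpl K y) j) := by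
      rw [← Finset.sum_add_distrib]; exact Finset.sum_congr rfl fun j _ => S.split j _
    have hd := abs_le.mp (abs_sum_Ico_sub_le_of_drift hdrift hmn')
    have hlo1 : -r * (((n : ℕ) : ℝ) - ((m : ℕ) : ℝ))
        ≤ ∑ j ∈ Finset.Ico (m : ℕ) n, S.β1 j (prefixOf (cpl K y) j) := by
      have h := Finset.card_nsmul_le_sum (Finset.Ico (m : ℕ) n) (fun j => S.β1 j (prefixOf (cpl K y) j)) (-r)
        fun j hj => (hrem y hy j (lt_of_lt_of_le (Finset.mem_Ico.1 hj).2 hnK)).1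
      rw [Nat.card_Ico, nsmul_eq_mul, Nat.cast_sub hmn'] at h
      linarith
    have hhi1 : ∑ j ∈ Finset.Ico (m : ℕ) n, S.β1 j (prefixOf (cpl K y) j)
        ≤ r' * (((n : ℕ) : ℝ) - ((m : ℕ) : ℝ)) := by
      have h := Finset.sum_le_card_nsmul (Finset.Ico (m : ℕ) n) (fun j => S.β1 j (prefixOf (cpl K y) j)) r'
        fun j hj => (hrem y hy j (lt_of_lt_of_le (Finset.mem_Ico.1 hj).2 hnK)).2
      rw [Nat.card_Ico, nsmul_eq_mul, Nat.cast_sub hmn'] at h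
      linarith
    rw [hdiff, hsplit]
    constructor <;> nlinarith [hd.1, hd.2, hlo1, hhi1]

/-- `EndpointExistence` WITH THE RUN LOCATED: same quantifier prefix as `DagBinding.EndpointExistence` (:485), and the
tuned run's inverse squared couplings form a member of the inter-scale tube at `(g, K)` — so every downstream consumer
quantifying over the tuned runs (the spine slot `HybridNE7Under D (EndpointExistence …)` of the apex
`T4ContinuumYM4Torus.continuumYM4_torus_of_endpointExistence` :814) meets only (2.6)-class histories. [cite: Balaban1987RG1, Thm 2 p.259 (endpoint-existence half, typed form `DagBinding.EndpointExistence`, here LOCATED in the inter-scale class; a statement shape ∕ bookkeeping, Thm 2 itself is not asserted)] -/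
def EndpointExistenceWithin (C : B12.Construction) (b A r r' : ℝ) : Prop :=
  ∀ m : ℕ, ∃ γ₂ : ℝ, 0 < γ₂ ∧ ∀ γ : ℝ, 0 < γ → γ ≤ γ₂ →
    ∃ gstar : ℝ, 0 < gstar ∧ ∀ g : ℝ, 0 < g → g ≤ gstar →
      ∀ K : ℕ, ∃ g0 : ℝ, (C ⟨K, m, g0⟩).flow.InInterval γ K ∧ (C ⟨K, m, g0⟩).flow.g K = g ∧
        (fun k : Fin (K + 1) => 1 / ((C ⟨K, m, g0⟩).flow.g k) ^ 2) ∈ InterScaleTube K g b A r r'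

/-- The located END rung implies the tree's `DagBinding.EndpointExistence` (forget the location). [cite: Balaban1987RG1, Thm 2 p.259 (endpoint-existence half, typed form `DagBinding.EndpointExistence`, here LOCATED in the inter-scale class; a statement shape ∕ bookkeeping, Thm 2 itself is not asserted)] -/
theorem endpointExistence_of_within {C : B12.Construction} {b A r r' : ℝ} (h : EndpointExistenceWithin C b A r r') :
    EndpointExistence C := by
  intro m
  obtain ⟨γ₂, hγ₂, H⟩ := h m
  refine ⟨γ₂, hγ₂, fun γ hγ hγle => ?_⟩
  obtain ⟨gstar, hgstar, Hg⟩ := H γ hγ hγle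
  refine ⟨gstar, hgstar, fun g hg hgle K => ?_⟩
  obtain ⟨g0, hI, hK, -⟩ := Hg g hg hgle K
  exact ⟨g0, hI, hK⟩

end Tube

end Literature.MathematicalPhysics.QuantumFieldTheory.Balaban1983to89.NodeOClassTube

end
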